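import Summits.QuantumFields.QCD.Theses.PauliWegnerSea
import Literature.MathematicalPhysics.QuantumFieldTheory.QCDPhaseQuenched

/-!
# Bridges for line `Sketch` of crux `PauliWegnerSea.ChiralOneScaleTrajectory` (stmt-QuantumFields-17512)

Two pieces of bookkeeping around the registered skeleton
(`Cruxes/ChiralOneScaleTrajectory/Lines/Sketch.lean`, stubs `stub_pionWickNumerator`,
`stub_chiralityTransfer`, `stub_packageSignedPin`):

* `oneScaleTrajectory_of_chiralOneScaleTrajectory` — the crux implies the support item
  `OneScaleTrajectory` (stmt-QuantumFields-11513) by forgetting the chirality conjunct (the clause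
  texts are byte-identical), so every negative finding on 11513 (Cruxes/OneScaleTrajectory/Disproof,
  the two dead lines) transfers to this crux verbatim.
* `signedPin_of_unsignedPin_two` — for `N_f = 2` at a DEGENERATE bare-mass tuple `(t, t)` the signed
  Wilson determinant `det D = (det D_W(t))²` is the non-negative real `|det D|` (γ₅-hermiticity makes
  `det D_W(t)` real, Montvay–Münster (5.16)), so the honest (signed) second-moment quotient of the
  transfer stub `stub_chiralityTransfer` IS the crux's own `|det|`-weighted (phase-quenched) second
  moment: the "signed pin" demanded by `stub_packageSignedPin` at `N_f = 2` is implied by the unsigned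
  pin in crux currency (card one-volume-goldstone-witness, `VanishingRatePin₂`).

Sources: I. Montvay, G. Münster, *Quantum Fields on a Lattice* (1994), §5.1.2 (5.16) (reality of the
Wilson determinant); folklore bookkeeping otherwise.
-/

noncomputable section

namespace Summit.QuantumFields.QCD.Cruxes.ChiralOneScaleTrajectory.GoldstoneWitness

open scoped BigOperators
open MeasureTheory Filter
open Literature.MathematicalPhysics.QuantumFieldTheory Literature.MathematicalPhysics.QuantumLattice
  Literature.Probability.LatticeModels

/-- **The crux implies the support item `OneScaleTrajectory` (stmt-QuantumFields-11513)** by dropping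
the conjunct `reg.IsChiralAtZero`; the four package clauses are passed through verbatim. -/
theorem oneScaleTrajectory_of_chiralOneScaleTrajectory :
    Summit.QuantumFields.QCD.Theses.PauliWegnerSea.ChiralOneScaleTrajectory →
      Summit.QuantumFields.QCD.Theses.PauliWegnerSea.OneScaleTrajectory := by
  intro h Nf hNf
  obtain ⟨reg, hMS, -, hAS, hpkg⟩ := h Nf hNf
  exact ⟨reg, hMS, hAS, hpkg⟩

/-- **For two degenerate flavours the signed Wilson determinant is its own modulus**:
`det D(U; t, t) = (det D_W(U,t))² = |det D(U; t, t)|` as complex numbers (`det D_W(U,t)` is real by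
γ₅-hermiticity). [Montvay–Münster 1994, §5.1.2 (5.16)] -/
theorem det_diracMatrix_two_degenerate_eq_norm {L : ℕ} [NeZero L]
    (U : GaugeConfig 4 L (Matrix.specialUnitaryGroup (Fin 3) ℂ)) (t : ℝ) :
    (diracMatrix U fun _ : Fin 2 => t).det = ((‖(diracMatrix U fun _ : Fin 2 => t).det‖ : ℝ) : ℂ) := by
  have hre : fermionDet (wilsonDirac (fundamentalRep (Fin 3)) U t 1) =
      (((fermionDet (wilsonDirac (fundamentalRep (Fin 3)) U t 1)).re : ℝ) : ℂ) :=
    Complex.ext (by simp) (by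
      simpa using fermionDet_wilsonDirac_im_holds (L := L) (fundamentalRep (Fin 3))
        (fun g => fundamentalRep_mem_unitaryGroup g) U t 1)
  rw [det_diracMatrix, Fin.prod_univ_two, hre]
  set r : ℝ := (fermionDet (wilsonDirac (fundamentalRep (Fin 3)) U t 1)).re
  rw [norm_mul, Complex.norm_real, Real.norm_eq_abs]
  push_cast
  rw [← sq, ← sq]
  exact_mod_cast (sq_abs r).symm

/-- **Unsigned ⇒ signed pin at `N_f = 2`.** At the degenerate tuple the signed second-moment quotient
`(∫ det D · Σ|G_f|² dμ_W)/(∫ det D dμ_W)` of `stub_chiralityTransfer` is the real phase-quenched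
quotient `(∫ |det D| Σ|G_f|² dμ_W)/(∫ |det D| dμ_W)` cast to `ℂ`, whose norm dominates it; hence a
frequently-violated decay certificate for the crux's own `|det|`-weighted second moment (card
one-volume-goldstone-witness, `VanishingRatePin₂`) is one for the signed quotient. -/
theorem signedPin_of_unsignedPin_two :
    ∀ (reg : QCDRegularisation 2) (f : Fin 2), (∀ ε : ℝ, 0 < ε → ∃ m : ℝ, 0 < m ∧ ∀ C : ℝ, ∃ᶠ k in atTop, ∃ S : ℕ, reg.L k ≤ S ∧ ∃ n : ℕ, n ≤ S ∧ C * Real.exp (-(ε * (reg.a k * n))) < (∫ U : GaugeConfig 4 (2 * S + 1) (Matrix.specialUnitaryGroup (Fin 3) ℂ), ‖(diracMatrix U fun _ : Fin 2 => reg.mcrit k + reg.a k * m / reg.Zm k).det‖ * (∑ a : Fin 3, ∑ i : Fin 4, ∑ b : Fin 3, ∑ j : Fin 4, ‖(diracMatrix U fun _ : Fin 2 => reg.mcrit k + reg.a k * m / reg.Zm k)⁻¹ (quarkEquiv (f, (Torus.proj (2 * S + 1) 0, a, i))) (quarkEquiv (f, (Torus.proj (2 * S + 1) (Pi.single 0 (n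 : ℤ)), b, j)))‖ ^ (2 : ℕ)) ∂(wilsonMeasure (fundamentalRep (Fin 3)) (reg.β k))) / (∫ U : GaugeConfig 4 (2 * S + 1) (Matrix.specialUnitaryGroup (Fin 3) ℂ), ‖(diracMatrix U fun _ : Fin 2 => reg.mcrit k + reg.a k * m / reg.Zm k).det‖ ∂(wilsonMeasure (fundamentalRep (Fin 3)) (reg.β k)))) → ∀ ε : ℝ, 0 < ε → ∃ m : ℝ, 0 < m ∧ ∀ C : ℝ, ∃ᶠ k in atTop, ∃ S : ℕ, reg.L k ≤ S ∧ ∃ n : ℕ, n ≤ S ∧ C * Real.exp (-(ε * (reg.a k * n))) < ‖(∫ U : GaugeConfig 4 (2 * S + 1) (Matrix.specialUnitaryGroup (Fin 3) ℂ), (diracMatrix U fun _ : Fin 2 => reg.mcrit k + reg.a k * m / reg.Zm k).det * ((∑ a : Fin 3, ∑ i : Fin 4, ∑ b : Fin 3, ∑ j : Fin 4, ‖(diracMatrix U fun _ : Fin 2 => reg.mcrit k + reg.a k * m / reg.Zm k)⁻¹ (quarkEquiv (f, (Torus.proj (2 * S + 1) 0, a, i))) (quarkEquiv (f, (Torus.proj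 (2 * S + 1) (Pi.single 0 (n : ℤ)), b, j)))‖ ^ (2 : ℕ) : ℝ) : ℂ) ∂(wilsonMeasure (fundamentalRep (Fin 3)) (reg.β k))) / (∫ U : GaugeConfig 4 (2 * S + 1) (Matrix.specialUnitaryGroup (Fin 3) ℂ), (diracMatrix U fun _ : Fin 2 => reg.mcrit k + reg.a k * m / reg.Zm k).det ∂(wilsonMeasure (fundamentalRep (Fin 3)) (reg.β k)))‖ := by
  intro reg f h ε hε
  obtain ⟨m, hm, hC⟩ := h ε hε
  refine ⟨m, hm, fun C => ?_⟩
  refine (hC C).mono fun k hk => ?_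
  obtain ⟨S, hS, n, hn, hlt⟩ := hk
  refine ⟨S, hS, n, hn, hlt.trans_le ?_⟩
  set mq : Fin 2 → ℝ := fun _ => reg.mcrit k + reg.a k * m / reg.Zm k with hmq
  set μ := wilsonMeasure (d := 4) (L := 2 * S + 1) (fundamentalRep (Fin 3)) (reg.β k) with hμ
  set X : GaugeConfig 4 (2 * S + 1) (Matrix.specialUnitaryGroup (Fin 3) ℂ) → ℝ := fun U =>
    ∑ a : Fin 3, ∑ i : Fin 4, ∑ b : Fin 3, ∑ j : Fin 4,
      ‖(diracMatrix U mq)⁻¹ (quarkEquiv (f, (Torus.proj (2 * S + 1) 0, a, i)))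
        (quarkEquiv (f, (Torus.proj (2 * S + 1) (Pi.single 0 (n : ℤ)), b, j)))‖ ^ (2 : ℕ) with hX
  have hdet : ∀ U : GaugeConfig 4 (2 * S + 1) (Matrix.specialUnitaryGroup (Fin 3) ℂ),
      (diracMatrix U mq).det = ((‖(diracMatrix U mq).det‖ : ℝ) : ℂ) := fun U =>
    det_diracMatrix_two_degenerate_eq_norm U _
  have hnum : (∫ U, (diracMatrix U mq).det * ((X U : ℝ) : ℂ) ∂μ) =
      ((∫ U, ‖(diracMatrix U mq).det‖ * X U ∂μ : ℝ) : ℂ) := by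
    rw [← integral_complex_ofReal]
    refine integral_congr_ae (Eventually.of_forall fun U => ?_)
    beta_reduce
    rw [Complex.ofReal_mul, ← hdet U]
  have hden : (∫ U, (diracMatrix U mq).det ∂μ) = ((∫ U, ‖(diracMatrix U mq).det‖ ∂μ : ℝ) : ℂ) := by
    rw [← integral_complex_ofReal]
    exact integral_congr_ae (Eventually.of_forall fun U => hdet U)
  rw [hnum, hden, ← Complex.ofReal_div, Complex.norm_real, Real.norm_eq_abs]
  exact le_abs_self _

end Summit.QuantumFields.QCD.Cruxes.ChiralOneScaleTrajectory.GoldstoneWitness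

end
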